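import Literature.Analysis.Calculus.SmoothCutoff
import Mathlib.Analysis.InnerProductSpace.Calculus
import Mathlib.Analysis.InnerProductSpace.PiL2
import Mathlib.Analysis.Calculus.MeanValue
import HarnessLib

/-!
# The smooth hard-core cutoff `f_K` of Richthammer's construction (Richthammer 2007, §5.1)

Companion of `HardDiskTranslationInvarianceSteps.lean` (provefact
`Literature.Barriers.AtomisticToContinuum.HardDisk.Richthammer2007_hardDisk`): the cutoff entering
the auxiliary functions `m_{x',t}` of the generalised translation (§5.4). "Let `f_K : ℝ² → ℝ` be a
function such that `f_K` is smooth, `f_K = 0` on `K` and `f_K = 1` on `(K_ε)ᶜ`", with the finite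
constant `c_f := sup{|f_K'(x)| : x ∈ ℝ²}` [Richthammer2007, §5.1, (5.2)]. For the Euclidean unit
disc `K` and `K_ε` the open ball of radius `1 + ε` we take the explicit choice
`f_K(x) = smoothTransition((|x|₂² - 1)/((1+ε)² - 1))`, smooth as a composite of Mathlib's
`Real.smoothTransition` with the smooth `|x|₂²`, and prove:

* `fK_eq_zero` (`f_K = 0` on `K`), `fK_eq_one` (`f_K = 1` off `K_ε`), `fK_nonneg`, `fK_le_one`,
  `fK_lt_one_iff` (`f_K < 1 ↔ |x|₂ < 1 + ε`), `contDiff_fK`;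
* `cF ε` — an explicit finite `c_f ≥ 0` with `‖f_K'(x)‖ ≤ c_f` everywhere (`norm_fderiv_fK_le`),
  and the Lipschitz estimate `abs_fK_sub_fK_le : |f_K(y) - f_K(x)| ≤ c_f |y - x|₂` (mean value
  inequality) — what "`c_f := sup |f_K'|`" is used for in Lemmas 15–17.

## References

* [Richthammer2007] T. Richthammer, *Translation-invariance of two-dimensional Gibbsian point
  processes*, Comm. Math. Phys. 274 (2007) 81–122, arXiv:0706.3637: §5.1 (p. 10, `f_K`, `c_K`,
  `c_f`, display (5.2) of the hub count).
-/

noncomputable section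

open Set

namespace Literature.Barriers.AtomisticToContinuum.HardDisk

/-- The plane. -/
local notation "E2" => EuclideanSpace ℝ (Fin 2)

/-- The normalisation `(1+ε)² - 1` of the squared radius. [folklore] -/
def sqWidth (ε : ℝ) : ℝ := (1 + ε) ^ 2 - 1

/-- `(1+ε)² - 1 > 0` for `ε > 0`. [folklore] -/
theorem sqWidth_pos {ε : ℝ} (hε : 0 < ε) : 0 < sqWidth ε := by
  unfold sqWidth; nlinarith

/-- **The cutoff `f_K`** for the Euclidean unit disc `K` and its `ε`-enlargement `K_ε`:
`f_K(x) = smoothTransition((|x|₂² - 1)/((1+ε)² - 1))` (an explicit choice of the smooth `f_K` of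
Richthammer 2007, §5.1). [cite: Richthammer2007, §5.1 (p. 10)] -/
def fK (ε : ℝ) (x : E2) : ℝ := Real.smoothTransition ((‖x‖ ^ 2 - 1) / sqWidth ε)

/-- `0 ≤ f_K`. [cite: Richthammer2007, §5.1 (p. 10)] -/
theorem fK_nonneg (ε : ℝ) (x : E2) : 0 ≤ fK ε x := Real.smoothTransition.nonneg _

/-- `f_K ≤ 1`. [cite: Richthammer2007, §5.1 (p. 10)] -/
theorem fK_le_one (ε : ℝ) (x : E2) : fK ε x ≤ 1 := Real.smoothTransition.le_one _

/-- **`f_K = 0` on the hard core `K = {|x|₂ ≤ 1}`.** [cite: Richthammer2007, §5.1 (p. 10)] -/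
theorem fK_eq_zero {ε : ℝ} (hε : 0 < ε) {x : E2} (hx : ‖x‖ ≤ 1) : fK ε x = 0 := by
  unfold fK
  refine Real.smoothTransition.zero_of_nonpos (div_nonpos_of_nonpos_of_nonneg ?_ (sqWidth_pos hε).le)
  nlinarith [norm_nonneg x]

/-- **`f_K = 1` off the enlargement `K_ε = {|x|₂ < 1 + ε}`.** [cite: Richthammer2007, §5.1 (p. 10)] -/
theorem fK_eq_one {ε : ℝ} (hε : 0 < ε) {x : E2} (hx : 1 + ε ≤ ‖x‖) : fK ε x = 1 := by
  unfold fK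
  refine Real.smoothTransition.one_of_one_le ?_
  rw [le_div_iff₀ (sqWidth_pos hε), one_mul]
  unfold sqWidth
  nlinarith [norm_nonneg x]

/-- `f_K(x) < 1` exactly on `K_ε`. [folklore] -/
theorem fK_lt_one_iff {ε : ℝ} (hε : 0 < ε) {x : E2} : fK ε x < 1 ↔ ‖x‖ < 1 + ε := by
  constructor
  · intro h
    by_contra hx
    exact absurd (fK_eq_one hε (le_of_not_gt hx)) (ne_of_lt h)
  · intro hx
    unfold fK
    refine Real.smoothTransition.lt_one_of_lt_one ?_
    rw [div_lt_iff₀ (sqWidth_pos hε), one_mul]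
    unfold sqWidth
    have h0 := norm_nonneg x
    nlinarith

/-- `f_K` is smooth. [cite: Richthammer2007, §5.1 (p. 10)] -/
theorem contDiff_fK (ε : ℝ) {n : ℕ∞} : ContDiff ℝ n (fK ε) := by
  unfold fK
  exact Real.smoothTransition.contDiff.comp (((contDiff_norm_sq ℝ).sub contDiff_const).div_const _)

/-- `f_K` is differentiable. [folklore] -/
theorem differentiable_fK (ε : ℝ) : Differentiable ℝ (fK ε) :=
  (contDiff_fK ε (n := 1)).differentiable (by simp)

/-- `f_K` is continuous. [folklore] -/
theorem continuous_fK (ε : ℝ) : Continuous (fK ε) := (differentiable_fK ε).continuous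

/-! ### The derivative bound `c_f` -/

/-- A bound on `|smoothTransition'|` (the tree's `exists_bound_deriv_smoothTransition`). [folklore] -/
def smoothTransitionDerivBound : ℝ :=
  Classical.choose Literature.Analysis.Calculus.exists_bound_deriv_smoothTransition

/-- The defining property of the bound. [folklore] -/
theorem smoothTransitionDerivBound_spec :
    0 ≤ smoothTransitionDerivBound ∧ ∀ t, |deriv Real.smoothTransition t| ≤ smoothTransitionDerivBound :=
  Classical.choose_spec Literature.Analysis.Calculus.exists_bound_deriv_smoothTransition

/-- **The constant `c_f`** bounding `|f_K'|`: `D · 2(1+ε)/((1+ε)² - 1)` with `D` a bound on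
`|smoothTransition'|` (Richthammer 2007, §5.1: "`c_f := sup{|f_K'(x)| : x ∈ ℝ²}`", any finite
upper bound serves). [cite: Richthammer2007, §5.1 (p. 10)] -/
def cF (ε : ℝ) : ℝ := smoothTransitionDerivBound * (2 * (1 + ε) / sqWidth ε)

/-- `c_f ≥ 0` (for `ε > 0`). [folklore] -/
theorem cF_nonneg {ε : ℝ} (hε : 0 < ε) : 0 ≤ cF ε :=
  mul_nonneg smoothTransitionDerivBound_spec.1
    (div_nonneg (by linarith) (sqWidth_pos hε).le)

/-- The chain rule for `f_K = smoothTransition ∘ ((|·|₂² - 1)/((1+ε)²-1))`. [folklore] -/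
theorem hasFDerivAt_fK (ε : ℝ) (x : E2) :
    HasFDerivAt (fK ε) (deriv Real.smoothTransition ((‖x‖ ^ 2 - 1) * (sqWidth ε)⁻¹) •
      ((sqWidth ε)⁻¹ • ((2 : ℕ) • innerSL ℝ x))) x := by
  have h1 : HasFDerivAt (fun y : E2 => (‖y‖ ^ 2 - 1) * (sqWidth ε)⁻¹)
      ((sqWidth ε)⁻¹ • ((2 : ℕ) • innerSL ℝ x)) x :=
    ((hasStrictFDerivAt_norm_sq x).hasFDerivAt.sub_const 1).mul_const _
  have h2 : HasDerivAt Real.smoothTransition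
      (deriv Real.smoothTransition ((‖x‖ ^ 2 - 1) * (sqWidth ε)⁻¹)) ((‖x‖ ^ 2 - 1) * (sqWidth ε)⁻¹) :=
    (Literature.Analysis.Calculus.differentiable_smoothTransition _).hasDerivAt
  have hfun : fK ε = Real.smoothTransition ∘ fun y : E2 => (‖y‖ ^ 2 - 1) * (sqWidth ε)⁻¹ := by
    funext y
    simp only [fK, Function.comp_apply, div_eq_mul_inv]
  rw [hfun]
  exact h2.comp_hasFDerivAt x h1

/-- **`‖f_K'(x)‖ ≤ c_f` everywhere** (the derivative of `smoothTransition` vanishes unless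
`1 ≤ |x|₂ ≤ 1 + ε`, where `‖(|·|₂²)'‖ = 2|x|₂ ≤ 2(1+ε)`). [cite: Richthammer2007, §5.1 (p. 10)] -/
theorem norm_fderiv_fK_le {ε : ℝ} (hε : 0 < ε) (x : E2) : ‖fderiv ℝ (fK ε) x‖ ≤ cF ε := by
  rw [(hasFDerivAt_fK ε x).fderiv]
  set t : ℝ := (‖x‖ ^ 2 - 1) * (sqWidth ε)⁻¹ with ht
  have hD := smoothTransitionDerivBound_spec
  have hw := sqWidth_pos hε
  have hL : ‖((2 : ℕ) • innerSL ℝ x : E2 →L[ℝ] ℝ)‖ ≤ 2 * ‖x‖ := by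
    refine norm_nsmul_le.trans (le_of_eq ?_)
    rw [innerSL_apply_norm, Nat.cast_ofNat]
  have hnorm : ‖deriv Real.smoothTransition t • ((sqWidth ε)⁻¹ • ((2 : ℕ) • innerSL ℝ x))‖ ≤
      |deriv Real.smoothTransition t| * ((sqWidth ε)⁻¹ * (2 * ‖x‖)) := by
    rw [norm_smul, norm_smul, Real.norm_eq_abs, Real.norm_eq_abs, abs_of_pos (inv_pos.2 hw)]
    exact mul_le_mul_of_nonneg_left (mul_le_mul_of_nonneg_left hL (inv_pos.2 hw).le) (abs_nonneg _)
  rcases le_or_gt ‖x‖ (1 + ε) with hx | hx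
  · -- inside the closed ball of radius `1 + ε`
    calc ‖deriv Real.smoothTransition t • ((sqWidth ε)⁻¹ • ((2 : ℕ) • innerSL ℝ x))‖
        ≤ |deriv Real.smoothTransition t| * ((sqWidth ε)⁻¹ * (2 * ‖x‖)) := hnorm
      _ ≤ smoothTransitionDerivBound * ((sqWidth ε)⁻¹ * (2 * (1 + ε))) := by
          refine mul_le_mul (hD.2 t) ?_ (by positivity) hD.1
          exact mul_le_mul_of_nonneg_left (by linarith) (inv_pos.2 hw).le
      _ = cF ε := by unfold cF; rw [div_eq_mul_inv]; ring
  · -- outside: the derivative of `smoothTransition` vanishes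
    have ht1 : 1 ≤ t := by
      rw [ht, ← div_eq_mul_inv, le_div_iff₀ hw, one_mul]
      unfold sqWidth
      nlinarith [norm_nonneg x]
    rw [Literature.Analysis.Calculus.deriv_smoothTransition_of_one_le ht1, zero_smul, norm_zero]
    exact cF_nonneg hε

/-- **The Lipschitz estimate `|f_K(y) - f_K(x)| ≤ c_f |y - x|₂`** (mean value inequality).
[cite: Richthammer2007, §5.1 (p. 10)] -/
theorem abs_fK_sub_fK_le {ε : ℝ} (hε : 0 < ε) (x y : E2) : |fK ε y - fK ε x| ≤ cF ε * ‖y - x‖ := by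
  have h := convex_univ.norm_image_sub_le_of_norm_fderiv_le (f := fK ε)
    (fun z _ => (differentiable_fK ε z)) (fun z _ => norm_fderiv_fK_le hε z) (mem_univ x) (mem_univ y)
  rwa [Real.norm_eq_abs] at h

/-- In particular along the first coordinate axis: `|f_K(x + s e₁ - x') - f_K(x - x')| ≤ c_f |s|`
(the `e₁`-Lipschitz bound behind Lemma 15). [cite: Richthammer2007, §6.2 Lemma 15 (p. 13)] -/
theorem abs_fK_sub_fK_le_axis {ε : ℝ} (hε : 0 < ε) (x x' : E2) (s : ℝ) :
    |fK ε (x + s • EuclideanSpace.single 0 (1 : ℝ) - x') - fK ε (x - x')| ≤ cF ε * |s| := by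
  have h := abs_fK_sub_fK_le hε (x - x') (x + s • EuclideanSpace.single 0 (1 : ℝ) - x')
  have e : x + s • EuclideanSpace.single 0 (1 : ℝ) - x' - (x - x') = s • EuclideanSpace.single 0 (1 : ℝ) := by abel
  rw [e, norm_smul, Real.norm_eq_abs, PiLp.norm_single, norm_one, mul_one] at h
  exact h

end Literature.Barriers.AtomisticToContinuum.HardDisk

end
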